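import Summits.PneNP.PneNP.Theorems.RamseyUncertifiableRegularResolutionRungDefs
import Literature.Combinatorics.SimpleGraph.RamseyNumbers
import Mathlib.Analysis.SpecialFunctions.Log.Base
import Mathlib.Analysis.Complex.ExponentialBounds
import Mathlib.Data.Nat.Choose.Bounds

/-!
# Route RamseyUncertifiable, crux `RegularResolutionRung` (stmt-PneNP-9818), line `sound-path-bottleneck`:
stub `stub_erdosSzemeredi`

The registered stub `stub_erdosSzemeredi` of the line: for every `C > 0` there are `ε > 0` and `n₀`
such that every graph `G` on `Fin n`, `n ≥ n₀`, with neither a `k`-clique nor a `k`-independent set for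
some `k ≤ C log₂ n` has at least `ε n²` ordered adjacent pairs (`edgeCount G univ univ`). This is the
theorem of Erdős and Szemerédi (1972, "On a Ramsey type theorem", Period. Math. Hungar. 2, 295–299;
quoted as Lemma 2 of Kwan–Sudakov, arXiv:1711.02937): graphs of density `ε` have homogeneous sets of
size `≥ c log n / (ε log (1/ε))`. It is PROVED here (no cited fact is used), by the exchange /
pigeonhole argument, with the explicit constants `ε = 1 / (16 K²)`, `K = 32 (C + 1)`,
`n₀ = ⌈256 (C+1)²⌉`:

* `L` = vertices of degree `≤ 4εn` (`|L| > 3n/4` since `Σ deg < ε n²`); `I ⊆ L` an independent set of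
  maximum size among independent subsets of `L`, `α = |I| ≤ k - 1 =: m`;
* the patterns `N(v) ∩ I` have total size `Σ_{u ∈ I} deg u ≤ 4εnα`, so with `s = ⌊16εα⌋` at most
  `n/4` vertices have a pattern of size `> s`, and the set `X ⊆ L ∖ I` of the others has `|X| > n/4`;
* EXCHANGE: if `J ⊆ X` is independent and all `v ∈ J` have the same pattern `P`, then `(I ∖ P) ∪ J`
  is an independent subset of `L`, so `|J| ≤ |P| ≤ s`; with Erdős–Szekeres
  (`Literature.Combinatorics.SimpleGraph.exists_clique_or_indep_of_choose_le_card`, proved in the tree)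
  every pattern class has `< C(m+s, m)` elements, and there are `≤ Σ_{j ≤ s} C(α, j) ≤ C(m+s, s)`
  patterns, whence `n/4 < C(m+s, s)²`;
* ANALYSIS (`erdosSzemeredi_choose_sq_le`): `C(m+s, s) ≤ (2m)^s/s! = (K²)^s (2m/K²)^s/s!
  ≤ (K²)^{m/K²} e^{2m/K²} ≤ e^{4m/K} ≤ e^{(log n)/4}` for `m ≤ C log₂ n`, so `C(m+s,s)² ≤ √n ≤ n/4`.

All statements live in the namespace of the line's vocabulary
(`Theorems/RamseyUncertifiableRegularResolutionRungDefs.lean`).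
-/

open scoped BigOperators

namespace Summit.PneNP.PneNP.Cruxes.RegularResolutionRung.SoundPathBottleneck

open Finset
open Literature.Combinatorics.SimpleGraph (exists_clique_or_indep_of_choose_le_card)

set_option linter.dupNamespace false -- Summit.PneNP.PneNP: single-conjunct summit

/-! ## Arithmetic -/

/-- Partial row sums of Pascal's triangle: `Σ_{j ≤ s} C(a, j) ≤ C(a + s, s)` (induction on `s` with
Pascal's rule). -/
theorem erdosSzemeredi_sum_choose_le (a : ℕ) :
    ∀ s : ℕ, ∑ j ∈ range (s + 1), a.choose j ≤ (a + s).choose s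
  | 0 => by simp
  | s + 1 => by
    rw [sum_range_succ]
    have h1 := erdosSzemeredi_sum_choose_le a s
    have h2 : a.choose (s + 1) ≤ (a + s).choose (s + 1) :=
      Nat.choose_le_choose _ (Nat.le_add_right a s)
    have h3 : (a + (s + 1)).choose (s + 1) = (a + s).choose s + (a + s).choose (s + 1) :=
      Nat.choose_succ_succ' (a + s) s
    omega

/-- The analytic inequality behind Erdős–Szemerédi, with `K = 32 (C + 1)`: if `16 ≤ n`,
`m ≤ C log₂ n` and `s ≤ m / K²`, then `C(m + s, s)² ≤ n / 4`. Proof: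
`C(m+s, s) ≤ (2m)^s / s! = (K²)^s · (2m/K²)^s / s! ≤ (K²)^{m/K²} · e^{2m/K²} = e^{(2 log K / K² + 2/K²) m}
≤ e^{4m/K} ≤ e^{(log n)/4}`, and `e^{(log n)/2} = √n ≤ n/4`. -/
theorem erdosSzemeredi_choose_sq_le (C : ℝ) (hC : 0 < C) (n m s : ℕ) (hn : 16 ≤ n)
    (hm : (m : ℝ) ≤ C * Real.logb 2 n) (hs : (s : ℝ) ≤ m / (32 * (C + 1)) ^ 2) :
    (((m + s).choose s : ℕ) : ℝ) ^ 2 ≤ n / 4 := by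
  set K : ℝ := 32 * (C + 1) with hK
  have hK32 : (32 : ℝ) ≤ K := by rw [hK]; linarith
  have hKpos : 0 < K := by linarith
  have hK2 : (1 : ℝ) ≤ K ^ 2 := by nlinarith
  have hK2ne : K ^ 2 ≠ 0 := by positivity
  have hm0 : (0 : ℝ) ≤ m := Nat.cast_nonneg m
  -- `s ≤ m`
  have hsm : s ≤ m := by
    have h : (s : ℝ) ≤ m := hs.trans (div_le_self hm0 hK2)
    exact_mod_cast h
  -- Step 1: `C(m+s, s) ≤ (2m)^s / s!`
  have h1 : (((m + s).choose s : ℕ) : ℝ) ≤ (2 * m : ℝ) ^ s / s.factorial := by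
    calc (((m + s).choose s : ℕ) : ℝ) ≤ _ := Nat.choose_le_pow_div s (m + s)
      _ ≤ (2 * m : ℝ) ^ s / s.factorial := by
          push_cast
          have h : (s : ℝ) ≤ m := by exact_mod_cast hsm
          gcongr
          linarith
  -- Step 2: split `(2m)^s = (K²)^s · (2m/K²)^s` and bound the two factors
  have h2 : (2 * m : ℝ) ^ s / s.factorial = (K ^ 2) ^ s * ((2 * m / K ^ 2) ^ s / s.factorial) := by
    rw [mul_div_assoc', ← mul_pow, mul_div_cancel₀ _ hK2ne]
  have h3 : (2 * m / K ^ 2 : ℝ) ^ s / s.factorial ≤ Real.exp (2 * m / K ^ 2) :=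
    Real.pow_div_factorial_le_exp _ (by positivity) s
  have h4 : (K ^ 2 : ℝ) ^ s ≤ Real.exp (2 * Real.log K * (m / K ^ 2)) := by
    calc (K ^ 2 : ℝ) ^ s = (K ^ 2) ^ ((s : ℕ) : ℝ) := (Real.rpow_natCast _ _).symm
      _ ≤ (K ^ 2) ^ ((m : ℝ) / K ^ 2) := Real.rpow_le_rpow_of_exponent_le hK2 hs
      _ = Real.exp (Real.log (K ^ 2) * (m / K ^ 2)) := Real.rpow_def_of_pos (by positivity) _
      _ = Real.exp (2 * Real.log K * (m / K ^ 2)) := by rw [Real.log_pow]; push_cast; ring_nf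
  have hlogK : Real.log K ≤ K := (Real.log_le_sub_one_of_pos hKpos).trans (by linarith)
  have h5 : (((m + s).choose s : ℕ) : ℝ) ≤ Real.exp (4 * m / K) := by
    calc (((m + s).choose s : ℕ) : ℝ) ≤ (K ^ 2) ^ s * ((2 * m / K ^ 2) ^ s / s.factorial) :=
          h1.trans_eq h2
      _ ≤ Real.exp (2 * Real.log K * (m / K ^ 2)) * Real.exp (2 * m / K ^ 2) :=
          mul_le_mul h4 h3 (by positivity) (by positivity)
      _ = Real.exp (2 * Real.log K * (m / K ^ 2) + 2 * m / K ^ 2) := (Real.exp_add _ _).symm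
      _ ≤ Real.exp (4 * m / K) := by
          rw [Real.exp_le_exp]
          have ha : 2 * Real.log K * (m / K ^ 2) ≤ 2 * K * (m / K ^ 2) :=
            mul_le_mul_of_nonneg_right (by linarith) (by positivity)
          have hb : 2 * K * (m / K ^ 2) = 2 * m / K := by
            field_simp
          have hc : 2 * (m : ℝ) / K ^ 2 ≤ 2 * m / K :=
            div_le_div_of_nonneg_left (by positivity) hKpos (by nlinarith)
          have hd : 2 * (m : ℝ) / K + 2 * m / K = 4 * m / K := by ring
          linarith
  -- Step 3: `4m/K ≤ (log n)/4`
  have hn16 : (16 : ℝ) ≤ n := by exact_mod_cast hn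
  have hn0 : (0 : ℝ) < n := by linarith
  have hlogn : 0 ≤ Real.log n := Real.log_nonneg (by linarith)
  have hm2 : (m : ℝ) ≤ 2 * C * Real.log n := by
    have hl2 : (1 / 2 : ℝ) ≤ Real.log 2 := by linarith [Real.log_two_gt_d9]
    have h2 : Real.logb 2 n ≤ 2 * Real.log n := by
      rw [← Real.log_div_log, div_le_iff₀ (Real.log_pos one_lt_two)]
      have := mul_le_mul_of_nonneg_left hl2 (by linarith : (0 : ℝ) ≤ 2 * Real.log n)
      linarith
    calc (m : ℝ) ≤ C * Real.logb 2 n := hm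
      _ ≤ C * (2 * Real.log n) := mul_le_mul_of_nonneg_left h2 hC.le
      _ = 2 * C * Real.log n := by ring
  have h6 : 4 * (m : ℝ) / K ≤ Real.log n / 4 := by
    rw [div_le_div_iff₀ hKpos (by norm_num : (0 : ℝ) < 4), hK]
    linarith
  -- Step 4: square and compare with `n / 4`
  set y : ℝ := Real.exp (Real.log n / 2) with hy
  have hy2 : y * y = n := by rw [hy, ← Real.exp_add, add_halves, Real.exp_log hn0]
  have hypos : 0 < y := Real.exp_pos _
  have hy4 : 4 ≤ y := by
    by_contra h
    have h' : y < 4 := not_le.1 h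
    have : y * y < 4 * 4 := mul_lt_mul'' h' h' hypos.le hypos.le
    linarith
  calc (((m + s).choose s : ℕ) : ℝ) ^ 2 ≤ (Real.exp (4 * m / K)) ^ 2 := by gcongr
    _ ≤ (Real.exp (Real.log n / 4)) ^ 2 := by gcongr
    _ = y := by rw [hy, sq, ← Real.exp_add]; congr 1; ring
    _ ≤ n / 4 := by rw [← hy2]; nlinarith

/-- The threshold: if `16 ≤ n` and `256 C² ≤ n` then `C log₂ n ≤ n / 4` (via `log n ≤ 2 e^{(log n)/2} = 2√n`
and `16 C ≤ √n`). -/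
theorem erdosSzemeredi_logb_le (C : ℝ) (hC : 0 < C) (n : ℕ) (hn : 16 ≤ n)
    (hCn : 256 * C ^ 2 ≤ (n : ℝ)) : C * Real.logb 2 n ≤ n / 4 := by
  have hn16 : (16 : ℝ) ≤ n := by exact_mod_cast hn
  have hn0 : (0 : ℝ) < n := by linarith
  set y : ℝ := Real.exp (Real.log n / 2) with hy
  have hy2 : y * y = n := by rw [hy, ← Real.exp_add, add_halves, Real.exp_log hn0]
  have hypos : 0 < y := Real.exp_pos _
  have hlogn : 0 ≤ Real.log n := Real.log_nonneg (by linarith)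
  have h1 : Real.log n ≤ 2 * y := by
    have := Real.add_one_le_exp (Real.log n / 2)
    linarith
  have h2 : Real.logb 2 n ≤ 2 * Real.log n := by
    have hl2 : (1 / 2 : ℝ) ≤ Real.log 2 := by linarith [Real.log_two_gt_d9]
    rw [← Real.log_div_log, div_le_iff₀ (Real.log_pos one_lt_two)]
    have := mul_le_mul_of_nonneg_left hl2 (by linarith : (0 : ℝ) ≤ 2 * Real.log n)
    linarith
  have h3 : 16 * C ≤ y := by
    by_contra h
    have h' : y < 16 * C := not_le.1 h
    have : y * y < (16 * C) * (16 * C) := mul_lt_mul'' h' h' hypos.le hypos.le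
    linarith
  calc C * Real.logb 2 n ≤ C * (4 * y) := mul_le_mul_of_nonneg_left (by linarith) hC.le
    _ = (4 * C) * y := by ring
    _ ≤ (y / 4) * y := mul_le_mul_of_nonneg_right (by linarith) hypos.le
    _ = n / 4 := by rw [← hy2]; ring

/-! ## The combinatorial core -/

/-- The exchange / pigeonhole core of Erdős–Szemerédi. If `G` on `Fin n` (`0 < n`) has no
`(m+1)`-clique and no `(m+1)`-independent set, `m ≤ n/4`, and fewer than `ε n²` ordered adjacent pairs,
then for `s := ⌊16 ε α⌋` (`α ≤ m` the size of a maximum independent set of low-degree vertices) one has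
`n / 4 < C(m + s, s)²`. -/
theorem erdosSzemeredi_core {n : ℕ} (G : SimpleGraph (Fin n)) [DecidableRel G.Adj] (m : ℕ) {ε : ℝ}
    (hε : 0 < ε) (hn : 0 < n) (hfree : G.CliqueFree (m + 1)) (hcfree : Gᶜ.CliqueFree (m + 1))
    (hm : (m : ℝ) ≤ n / 4) (he : (edgeCount G univ univ : ℝ) < ε * n * n) :
    ∃ s : ℕ, (s : ℝ) ≤ 16 * ε * m ∧ (n : ℝ) / 4 < ((((m + s).choose s : ℕ) : ℝ)) ^ 2 := by
  have hn' : (0 : ℝ) < n := by exact_mod_cast hn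
  -- degrees and the degree sum `Σ_v deg v = e(V, V) < ε n²`
  set deg : Fin n → ℕ := fun v => (univ.filter fun b => G.Adj v b).card with hdeg
  rw [edgeCount_eq_sum] at he
  push_cast at he
  have hsum : ∑ v, (deg v : ℝ) < ε * n * n := he
  -- Step 1: the low-degree vertices `L`; fewer than `n/4` vertices have degree `> 4εn`
  set L : Finset (Fin n) := univ.filter fun v => (deg v : ℝ) ≤ 4 * ε * n with hL
  set B₁ : Finset (Fin n) := univ.filter fun v => ¬ ((deg v : ℝ) ≤ 4 * ε * n) with hB₁
  have hLB₁ : L.card + B₁.card = n := by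
    rw [hL, hB₁, card_filter_add_card_filter_not (fun v => (deg v : ℝ) ≤ 4 * ε * n), card_univ,
      Fintype.card_fin]
  have hB₁lt : (B₁.card : ℝ) < n / 4 := by
    have h1 : (B₁.card : ℝ) * (4 * ε * n) ≤ ∑ v ∈ B₁, (deg v : ℝ) := by
      have := card_nsmul_le_sum B₁ (fun v => (deg v : ℝ)) (4 * ε * n)
        (fun v hv => le_of_lt (not_le.1 (mem_filter.1 hv).2))
      rwa [nsmul_eq_mul] at this
    have h2 : ∑ v ∈ B₁, (deg v : ℝ) ≤ ∑ v, (deg v : ℝ) :=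
      sum_le_sum_of_subset_of_nonneg (subset_univ _) fun _ _ _ => Nat.cast_nonneg _
    have h3 : (B₁.card : ℝ) * (4 * ε * n) < n / 4 * (4 * ε * n) := by
      calc (B₁.card : ℝ) * (4 * ε * n) ≤ ∑ v, (deg v : ℝ) := h1.trans h2
        _ < ε * n * n := hsum
        _ = n / 4 * (4 * ε * n) := by ring
    exact lt_of_mul_lt_mul_right h3 (by positivity)
  have hLgt : 3 * (n : ℝ) / 4 < L.card := by
    have : (L.card : ℝ) + B₁.card = n := by exact_mod_cast hLB₁
    linarith
  -- Step 2: a maximum independent subset `I` of `L`, `α = |I| ≤ m`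
  set 𝓘 : Finset (Finset (Fin n)) :=
    L.powerset.filter fun S => ∀ u ∈ S, ∀ v ∈ S, ¬ G.Adj u v with h𝓘
  obtain ⟨I, hI, hImax⟩ := exists_max_image 𝓘 card ⟨∅, by simp [h𝓘]⟩
  have hIL : I ⊆ L := mem_powerset.1 (mem_filter.1 hI).1
  have hIind : ∀ u ∈ I, ∀ v ∈ I, ¬ G.Adj u v := (mem_filter.1 hI).2
  have hαm : I.card ≤ m := by
    by_contra h
    have h' : m + 1 ≤ I.card := by omega
    exact hcfree.mono h' I
      ⟨fun u hu v hv huv => (G.compl_adj u v).2 ⟨huv, hIind u hu v hv⟩, rfl⟩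
  -- Step 3: patterns `N(v) ∩ I`; their total size is `Σ_{u ∈ I} deg u ≤ 4εnα`
  set pat : Fin n → Finset (Fin n) := fun v => I.filter fun u => G.Adj v u with hpat
  have hdc : ∑ v, ((pat v).card : ℝ) ≤ 4 * ε * n * I.card := by
    have h1 : ∑ v, (pat v).card = ∑ u ∈ I, deg u := by
      calc ∑ v, (pat v).card = ∑ v, ∑ u ∈ I, (if G.Adj v u then 1 else 0) := by
            simp only [hpat, card_filter]
        _ = ∑ u ∈ I, ∑ v, (if G.Adj v u then 1 else 0) := sum_comm
        _ = ∑ u ∈ I, (univ.filter fun v => G.Adj v u).card := by simp only [card_filter]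
        _ = ∑ u ∈ I, deg u := sum_congr rfl fun u _ => ?_
      simp only [hdeg]
      exact congrArg card (filter_congr fun v _ => G.adj_comm v u)
    have h1' : ∑ v, ((pat v).card : ℝ) = ∑ u ∈ I, (deg u : ℝ) := by
      have h := congrArg (Nat.cast : ℕ → ℝ) h1
      push_cast at h
      exact h
    have h2 := sum_le_card_nsmul I (fun u => (deg u : ℝ)) (4 * ε * n)
      fun u hu => (mem_filter.1 (hIL hu)).2
    rw [nsmul_eq_mul] at h2
    rw [h1']
    linarith
  -- the threshold `s = ⌊16εα⌋` and the vertices of `L ∖ I` with small / large patterns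
  set s : ℕ := ⌊16 * ε * I.card⌋₊ with hs
  have hs_le : (s : ℝ) ≤ 16 * ε * I.card := Nat.floor_le (by positivity)
  have hs_lt : 16 * ε * I.card < (s : ℝ) + 1 := Nat.lt_floor_add_one _
  set X : Finset (Fin n) := (L \ I).filter fun v => (pat v).card ≤ s with hX
  set B₂ : Finset (Fin n) := (L \ I).filter fun v => ¬ (pat v).card ≤ s with hB₂
  have hXB₂ : X.card + B₂.card + I.card = L.card := by
    rw [hX, hB₂, card_filter_add_card_filter_not (fun v => (pat v).card ≤ s),
      card_sdiff_add_card_eq_card hIL]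
  have hB₂le : (B₂.card : ℝ) ≤ n / 4 := by
    have h1 : (B₂.card : ℝ) * ((s : ℝ) + 1) ≤ ∑ v ∈ B₂, ((pat v).card : ℝ) := by
      have := card_nsmul_le_sum B₂ (fun v => ((pat v).card : ℝ)) ((s : ℝ) + 1) fun v hv => by
        have h : s < (pat v).card := not_le.1 (mem_filter.1 hv).2
        exact_mod_cast Nat.succ_le_of_lt h
      rwa [nsmul_eq_mul] at this
    have h2 : ∑ v ∈ B₂, ((pat v).card : ℝ) ≤ ∑ v, ((pat v).card : ℝ) :=
      sum_le_sum_of_subset_of_nonneg (subset_univ _) fun _ _ _ => Nat.cast_nonneg _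
    have h3 : (B₂.card : ℝ) * ((s : ℝ) + 1) ≤ n / 4 * ((s : ℝ) + 1) := by
      calc (B₂.card : ℝ) * ((s : ℝ) + 1) ≤ 4 * ε * n * I.card := h1.trans (h2.trans hdc)
        _ = n / 4 * (16 * ε * I.card) := by ring
        _ ≤ n / 4 * ((s : ℝ) + 1) := mul_le_mul_of_nonneg_left hs_lt.le (by positivity)
    exact le_of_mul_le_mul_right h3 (by positivity)
  have hXgt : (n : ℝ) / 4 < X.card := by
    have h1 : (X.card : ℝ) + B₂.card + I.card = L.card := by exact_mod_cast hXB₂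
    have h2 : (I.card : ℝ) ≤ n / 4 := le_trans (by exact_mod_cast hαm) hm
    linarith
  -- Step 4: every pattern class of `X` has at most `C(m+s, m)` elements (exchange + Erdős–Szekeres)
  set PP : Finset (Finset (Fin n)) := I.powerset.filter fun P => P.card ≤ s with hPP
  have hpatPP : ∀ v ∈ X, pat v ∈ PP := fun v hv =>
    mem_filter.2 ⟨mem_powerset.2 (filter_subset _ _), (mem_filter.1 hv).2⟩
  have hfib : ∀ P ∈ PP, (X.filter fun v => pat v = P).card ≤ (m + s).choose m := by
    intro P hP
    by_contra hlt
    have hle : (m + s).choose m ≤ (X.filter fun v => pat v = P).card := by omega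
    rcases exists_clique_or_indep_of_choose_le_card G (m + s) m s rfl _ hle with
      ⟨t, -, ht⟩ | ⟨t, htX, ht⟩
    · exact hfree t ht
    · -- `t`: an `(s+1)`-independent set with constant pattern `P`; exchange `P` for `t` inside `I`
      have hPI : P ⊆ I := mem_powerset.1 (mem_filter.1 hP).1
      have hPs : P.card ≤ s := (mem_filter.1 hP).2
      have htinfo : ∀ v ∈ t, v ∈ L ∧ v ∉ I ∧ pat v = P := fun v hv => by
        have h1 := mem_filter.1 (htX hv)
        have h2 := mem_sdiff.1 (mem_filter.1 h1.1).1
        exact ⟨h2.1, h2.2, h1.2⟩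
      have hJ : (I \ P) ∪ t ∈ 𝓘 := by
        refine mem_filter.2 ⟨mem_powerset.2 ?_, ?_⟩
        · intro v hv
          rcases mem_union.1 hv with hv | hv
          · exact hIL (mem_sdiff.1 hv).1
          · exact (htinfo v hv).1
        · intro u hu v hv hadj
          rcases mem_union.1 hu with hu | hu <;> rcases mem_union.1 hv with hv | hv
          · exact hIind u (mem_sdiff.1 hu).1 v (mem_sdiff.1 hv).1 hadj
          · have hu' := mem_sdiff.1 hu
            have h : u ∈ pat v := mem_filter.2 ⟨hu'.1, hadj.symm⟩
            rw [(htinfo v hv).2.2] at h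
            exact hu'.2 h
          · have hv' := mem_sdiff.1 hv
            have h : v ∈ pat u := mem_filter.2 ⟨hv'.1, hadj⟩
            rw [(htinfo u hu).2.2] at h
            exact hv'.2 h
          · by_cases huv : u = v
            · subst huv
              exact G.irrefl hadj
            · exact ((G.compl_adj u v).1 (ht.isClique hu hv huv)).2 hadj
      have hcard : ((I \ P) ∪ t).card = I.card - P.card + (s + 1) := by
        rw [card_union_of_disjoint, card_sdiff_of_subset hPI, ht.card_eq]
        exact disjoint_left.2 fun v hv hvt => (htinfo v hvt).2.1 (mem_sdiff.1 hv).1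
      have h1 := hImax _ hJ
      have h2 := card_le_card hPI
      omega
  -- Step 5: counting — `n/4 < |X| ≤ C(m+s, m) · |PP| ≤ C(m+s, s)²`
  have hPPcard : PP.card ≤ (m + s).choose s := by
    have h1 : PP ⊆ (range (s + 1)).biUnion fun j => I.powersetCard j := by
      intro P hP
      have hP' := mem_filter.1 hP
      exact mem_biUnion.2 ⟨P.card, mem_range.2 (Nat.lt_succ_of_le hP'.2),
        mem_powersetCard.2 ⟨mem_powerset.1 hP'.1, rfl⟩⟩
    calc PP.card ≤ ((range (s + 1)).biUnion fun j => I.powersetCard j).card := card_le_card h1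
      _ ≤ ∑ j ∈ range (s + 1), (I.powersetCard j).card := card_biUnion_le
      _ = ∑ j ∈ range (s + 1), I.card.choose j := by simp only [card_powersetCard]
      _ ≤ (I.card + s).choose s := erdosSzemeredi_sum_choose_le I.card s
      _ ≤ (m + s).choose s := Nat.choose_le_choose s (by omega)
  have hXle : X.card ≤ ((m + s).choose s) ^ 2 := by
    calc X.card ≤ (m + s).choose m * PP.card := card_le_mul_card_image_of_maps_to hpatPP _ hfib
      _ ≤ (m + s).choose s * (m + s).choose s := Nat.mul_le_mul Nat.choose_symm_add.le hPPcard
      _ = ((m + s).choose s) ^ 2 := (sq _).symm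
  refine ⟨s, hs_le.trans ?_, hXgt.trans_le (by exact_mod_cast hXle)⟩
  exact mul_le_mul_of_nonneg_left (by exact_mod_cast hαm) (by positivity)

/-! ## The registered stub -/

/-- **Erdős–Szemerédi (1972)**, registered stub `stub_erdosSzemeredi` of the line `sound-path-bottleneck`:
for every `C > 0` there are `ε > 0` (here `ε = 1 / (16 · (32 (C+1))²)`) and `n₀` (here `⌈256 (C+1)²⌉`)
such that every graph on `n ≥ n₀` vertices with neither a `k`-clique nor a `k`-independent set for some
`k ≤ C log₂ n` has at least `ε n²` ordered adjacent pairs. Source: P. Erdős, E. Szemerédi, *On a Ramsey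
type theorem*, Period. Math. Hungar. 2 (1972), 295–299 (also Lemma 2 of M. Kwan, B. Sudakov,
arXiv:1711.02937); proved here from `erdosSzemeredi_core`, `erdosSzemeredi_choose_sq_le` and
`erdosSzemeredi_logb_le`. -/
theorem stub_erdosSzemeredi :
    ∀ C : ℝ, 0 < C → ∃ ε : ℝ, 0 < ε ∧ ∃ n₀ : ℕ, ∀ n ≥ n₀,
      ∀ (G : SimpleGraph (Fin n)) [DecidableRel G.Adj] (k : ℕ), (k : ℝ) ≤ C * Real.logb 2 n →
        G.CliqueFree k → Gᶜ.CliqueFree k → ε * n * n ≤ (edgeCount G Finset.univ Finset.univ : ℝ) := by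
  intro C hC
  refine ⟨1 / (32 * (C + 1)) ^ 2 / 16, by positivity, ⌈256 * (C + 1) ^ 2⌉₊, ?_⟩
  intro n hn G _ k hk hfree hcfree
  have hn' : 256 * (C + 1) ^ 2 ≤ (n : ℝ) := (Nat.le_ceil _).trans (by exact_mod_cast hn)
  have hn16 : 16 ≤ n := by
    have h : (16 : ℝ) ≤ n := by nlinarith
    exact_mod_cast h
  have hCn : 256 * C ^ 2 ≤ (n : ℝ) := by nlinarith
  have hquarter := erdosSzemeredi_logb_le C hC n hn16 hCn
  -- `k ≥ 1`: the empty set is a `0`-clique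
  rcases k with _ | m
  · exact (SimpleGraph.not_cliqueFree_zero hfree).elim
  by_contra hlt
  have hlt' : (edgeCount G univ univ : ℝ) < 1 / (32 * (C + 1)) ^ 2 / 16 * n * n := not_le.1 hlt
  push_cast at hk
  have hm : (m : ℝ) ≤ n / 4 := by linarith
  have hmC : (m : ℝ) ≤ C * Real.logb 2 n := by linarith
  obtain ⟨s, hs, hlt2⟩ := erdosSzemeredi_core G m (by positivity) (by omega) hfree hcfree hm hlt'
  have hs' : (s : ℝ) ≤ m / (32 * (C + 1)) ^ 2 := by
    have e : 16 * (1 / (32 * (C + 1)) ^ 2 / 16) * (m : ℝ) = m / (32 * (C + 1)) ^ 2 := by ring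
    linarith
  have := erdosSzemeredi_choose_sq_le C hC n m s hn16 hmC hs'
  linarith

end Summit.PneNP.PneNP.Cruxes.RegularResolutionRung.SoundPathBottleneck
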